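import Literature.NumberTheory.EllipticCurves.KatoFineSelmerDualProofs
import HarnessLib

/-!
# The fine Selmer group RELAXED AT THE INFINITE PLACES, `Sel₀^{rel ∞}(K_∞, E[p^∞])`, over a `ℤ_p`-extension
# and its Pontryagin dual `X₀^{rel ∞}(E/K_∞)` as a `Λ`-module (definitions; cell `bsd-f1-sign2`, typer -ty g4, for crux C2 road (b″))

HONEST FRAMING: DEFINITIONS and unfolding / comparison lemmas only; nothing is asserted. The tree's fine Selmer group
`GreenbergSelmer.fineSelmerInfty κ M = strictSelmerInfty κ M (fineData M p)` (file `KatoFineSelmerDual`) imposes, besides the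
strict (= locally trivial) conditions at all finite places, the condition `infKer` at every infinite place — it is STRICT AT `∞`.
For `p` odd the archimedean local cohomology vanishes and the condition is empty; for `p = 2` and a REAL place `v` it is not:
`H¹(F_v, E[2^∞]) ≅ E(F_v)/E(F_v)_con` has order `1` or `2` («the order is 2 if `E[2]` is contained in `E(F_v)`»), and over the
cyclotomic tower the archimedean factor of Greenberg's target is `𝒫_E^{(v)}(F_∞) ≅ Hom(Λ/2Λ, ℤ/2ℤ)`, whose Pontryagin dual «is either zero
or isomorphic to `Λ/2Λ`» [cite: GreenbergLNM1716, §4, Lemma 4.6 and the two paragraphs before its proof (PDF pp. 105–107 of LNM 1716)].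
Dropping the archimedean clause gives the fine Selmer group RELAXED AT `∞`; its dual `X₀^{rel ∞}` differs from `X₀` by a quotient of
`(Λ/2Λ)^{#{v real : E[2] ⊂ E(F_v)}}` (Greenberg, loc. cit.), which is exactly the bookkeeping the `Δ_E > 0` netting of crux C2's road (b″)
needs (requester: bsd-line-att-p2 g3, INBOX 2026-08-28T02:50:57Z «a relaxed-at-∞ fine dual»).

Contents (mirroring `KatoFineSelmerDual` declaration by declaration):
* `GreenbergSelmer.strictSelmerGroupOverRelaxedInf H M p L` — Greenberg's strict Selmer group over `L = K̄^H` WITHOUT the `infKer`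
  clause; `mem_…_iff`, `strictSelmerGroupOver_le_relaxedInf`, equality when every `infKer` is `⊤`, `conjH1`-stability.
* `GreenbergSelmer.fineSelmerInftyRelaxedInf M κ` — the case `H = ker κ`, `L = fineData M p`; `fineSelmerInfty ≤ …RelaxedInf`.
* `WeierstrassCurve.fineSelmerInftyRelaxedInf W κ` (`M = W.geomPrimaryTorsion p`) and the hypothesis structure
  `WeierstrassCurve.FineSelmerDualDataRelaxedInf W κ γ` — EXACTLY the pattern of `FineSelmerDualData` with `Sel₀` replaced by
  `Sel₀^{rel ∞}`; `charIdeal`, `toFineDual`.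
* §3 EXISTENCE (proved, word for word `KatoFineSelmerDualProofs`): `conjFineSelmerInftyRelaxedInf`, local nilpotence of `conj_γ − 1`,
  the CONSTRUCTED datum `fineSelmerDualDataRelaxedInf κ hγ`, `nonempty_fineSelmerDualDataRelaxedInf`, `exists_fineSelmerDualDataRelaxedInf`
  (non-vacuity of every «`∀ D : W.FineSelmerDualDataRelaxedInf κ γ, …`»).

References: R. Greenberg, LNM 1716 (1999) §4 [GreenbergLNM1716]; R. Greenberg, Adv. Stud. Pure Math. 17 (1989) p. 98 [Greenberg1989];
K. Kato, Astérisque 295 (2004) Conj. 12.10 [Kato2004Asterisque].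
-/

noncomputable section

open scoped Classical

open NumberField IsDedekindDomain Field
open Literature.NumberTheory.GaloisRepresentations

universe u

namespace Literature.NumberTheory.EllipticCurves.GreenbergSelmer

variable {K : Type u} [Field K] [NumberField K]

section Selmer

variable (H : Subgroup (absoluteGaloisGroup K)) [H.Normal] (M : Type u) [AddCommGroup M]
  [DistribMulAction (absoluteGaloisGroup K) M] [TopologicalSpace M] [DiscreteTopology M]
  (p : ℕ) (L : Data K M p)

/-- **Greenberg's strict Selmer group over `L = K̄^H`, RELAXED AT THE INFINITE PLACES**: the classes `c ∈ H¹(H, M)` such that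
every conjugate `conj_σ c` is locally trivial at the chosen place above every finite `v ∤ p` (`awayKer`) and satisfies the strict
condition at the chosen place above every `v ∣ p` (`strictKer`) — i.e. `strictSelmerGroupOver` with the archimedean clause
`infKer` REMOVED (no condition at the infinite places; for `p = 2` and real places this is a genuinely larger group).
[cite: Greenberg1989, §1 p. 98] [cite: GreenbergLNM1716, §4, before Lemma 4.6 (PDF p. 106): the archimedean factor at p = 2] -/
def strictSelmerGroupOverRelaxedInf : AddSubgroup (subgroupH1 H M) :=
  (⨅ (v : HeightOneSpectrum (𝓞 K)) (_ : ((p : ℕ) : 𝓞 K) ∉ v.asIdeal)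
      (σ : absoluteGaloisGroup K), (awayKer H M v).comap (conjH1 H M σ)) ⊓
  ⨅ (v : HeightOneSpectrum (𝓞 K)) (hv : ((p : ℕ) : 𝓞 K) ∈ v.asIdeal) (σ : absoluteGaloisGroup K),
    ((L v hv).strictKer H).comap (conjH1 H M σ)

variable {H M p L}

/-- Membership in the strict Selmer group relaxed at `∞`: the two families of finite local conditions, and nothing at the
infinite places. [cite: Greenberg1989, §1 p. 98] -/
theorem mem_strictSelmerGroupOverRelaxedInf_iff (c : subgroupH1 H M) :
    c ∈ strictSelmerGroupOverRelaxedInf H M p L ↔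
      (∀ (v : HeightOneSpectrum (𝓞 K)), ((p : ℕ) : 𝓞 K) ∉ v.asIdeal →
          ∀ σ : absoluteGaloisGroup K, conjH1 H M σ c ∈ awayKer H M v) ∧
        ∀ (v : HeightOneSpectrum (𝓞 K)) (hv : ((p : ℕ) : 𝓞 K) ∈ v.asIdeal)
          (σ : absoluteGaloisGroup K), conjH1 H M σ c ∈ (L v hv).strictKer H := by
  simp only [strictSelmerGroupOverRelaxedInf, AddSubgroup.mem_inf, AddSubgroup.mem_iInf,
    AddSubgroup.mem_comap]

variable (H M p L) in
/-- The strict Selmer group is contained in its relaxed-at-`∞` version (one forgets the archimedean conditions).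
[cite: GreenbergLNM1716, §4, before Lemma 4.6 (PDF p. 106)] -/
theorem strictSelmerGroupOver_le_relaxedInf :
    strictSelmerGroupOver H M p L ≤ strictSelmerGroupOverRelaxedInf H M p L := by
  intro c hc
  rw [mem_strictSelmerGroupOver_iff] at hc
  rw [mem_strictSelmerGroupOverRelaxedInf_iff]
  exact ⟨hc.1, hc.2.2⟩

variable (H M p L) in
/-- When every archimedean condition is vacuous (`infKer H M w = ⊤` for all infinite `w` — «usually this group is zero», e.g.
`p` odd, or no real place, or `E[2] ⊄ E(F_v)`), relaxing at `∞` changes nothing.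
[cite: GreenbergLNM1716, §4, before Lemma 4.6 (PDF p. 106)] -/
theorem strictSelmerGroupOverRelaxedInf_eq_of_infKer_eq_top (h : ∀ w : InfinitePlace K, infKer H M w = ⊤) :
    strictSelmerGroupOverRelaxedInf H M p L = strictSelmerGroupOver H M p L := by
  refine le_antisymm (fun c hc ↦ ?_) (strictSelmerGroupOver_le_relaxedInf H M p L)
  rw [mem_strictSelmerGroupOverRelaxedInf_iff] at hc
  rw [mem_strictSelmerGroupOver_iff]
  exact ⟨hc.1, fun w σ ↦ by rw [h w]; exact AddSubgroup.mem_top _, hc.2⟩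

/-- The relaxed-at-`∞` strict Selmer group is stable under the conjugation action of `Γ_K` (the finite local conditions are
permuted by `γ`), so `Γ_K/H` acts on it. [cite: Greenberg1989, §1 p. 98] -/
theorem conjH1_mem_strictSelmerGroupOverRelaxedInf (γ : absoluteGaloisGroup K) {c : subgroupH1 H M}
    (hc : c ∈ strictSelmerGroupOverRelaxedInf H M p L) :
    conjH1 H M γ c ∈ strictSelmerGroupOverRelaxedInf H M p L := by
  have e : ∀ σ : absoluteGaloisGroup K, conjH1 H M σ (conjH1 H M γ c) = conjH1 H M (σ * γ) c :=
    fun σ ↦ by rw [conjH1_mul_holds H M σ γ]; rfl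
  rw [mem_strictSelmerGroupOverRelaxedInf_iff] at hc ⊢
  refine ⟨fun v hv σ ↦ ?_, fun v hv σ ↦ ?_⟩
  · rw [e]; exact hc.1 v hv (σ * γ)
  · rw [e]; exact hc.2 v hv (σ * γ)

end Selmer

section Fine

variable (M : Type u) [AddCommGroup M] [DistribMulAction (absoluteGaloisGroup K) M]
  [TopologicalSpace M] [DiscreteTopology M] {p : ℕ} [Fact p.Prime] (κ : ZpExtension K p)

/-- **The fine Selmer group relaxed at `∞`, `Sel₀^{rel ∞}(K_∞, M) ⊆ H¹(K_∞, M)`**, over the top of the `ℤ_p`-extension `κ`: locally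
trivial at every FINITE place of `K_∞` (the fine data `M⁺_v = 0` at `v ∣ p`), no condition at the infinite places.
[cite: GreenbergLNM1716, §4, before Lemma 4.6 (PDF p. 106)] [cite: Greenberg1989, §1 p. 98] -/
def fineSelmerInftyRelaxedInf : AddSubgroup (subgroupH1 κ.kerSubgroup M) :=
  strictSelmerGroupOverRelaxedInf κ.kerSubgroup M p (fineData M p)

/-- Unfolding (definitional). [cite: Greenberg1989, §1 p. 98] -/
theorem fineSelmerInftyRelaxedInf_eq :
    fineSelmerInftyRelaxedInf M κ = strictSelmerGroupOverRelaxedInf κ.kerSubgroup M p (fineData M p) := rfl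

/-- `Sel₀(K_∞, M) ≤ Sel₀^{rel ∞}(K_∞, M)`. [cite: GreenbergLNM1716, §4, before Lemma 4.6 (PDF p. 106)] -/
theorem fineSelmerInfty_le_fineSelmerInftyRelaxedInf : fineSelmerInfty M κ ≤ fineSelmerInftyRelaxedInf M κ :=
  strictSelmerGroupOver_le_relaxedInf κ.kerSubgroup M p (fineData M p)

/-- `Sel₀^{rel ∞}(K_∞, M)` is stable under the conjugation action of `Γ_K` (so `Γ = Gal(K_∞/K)` acts and the dual is a
`Λ`-module). [cite: Greenberg1989, §1 p. 98] -/
theorem conjH1_mem_fineSelmerInftyRelaxedInf (γ : absoluteGaloisGroup K) {c : subgroupH1 κ.kerSubgroup M}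
    (hc : c ∈ fineSelmerInftyRelaxedInf M κ) : conjH1 κ.kerSubgroup M γ c ∈ fineSelmerInftyRelaxedInf M κ :=
  conjH1_mem_strictSelmerGroupOverRelaxedInf γ hc

end Fine

end Literature.NumberTheory.EllipticCurves.GreenbergSelmer

namespace WeierstrassCurve

open Literature.NumberTheory.EllipticCurves Literature.NumberTheory.EllipticCurves.GreenbergSelmer

variable {K : Type u} [Field K] [NumberField K] (W : WeierstrassCurve K) {p : ℕ} [Fact p.Prime]
  (κ : ZpExtension K p) (γ : Field.absoluteGaloisGroup K)

/-- **`Sel₀^{rel ∞}(K_∞, E[p^∞])`**: the fine Selmer group of the `p`-primary torsion of `W` over the top of `κ`, relaxed at the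
infinite places, inside `H¹(K_∞, E[p^∞]) = W.subgroupH1 p κ.kerSubgroup`. [cite: GreenbergLNM1716, §4, before Lemma 4.6 (PDF p. 106)]
[cite: Kato2004Asterisque, Conj. 12.10 (p. 224)] -/
def fineSelmerInftyRelaxedInf : AddSubgroup (W.subgroupH1 p κ.kerSubgroup) :=
  GreenbergSelmer.fineSelmerInftyRelaxedInf (W.geomPrimaryTorsion p) κ

/-- `Sel₀(K_∞, E[p^∞]) ≤ Sel₀^{rel ∞}(K_∞, E[p^∞])`. [cite: GreenbergLNM1716, §4, before Lemma 4.6 (PDF p. 106)] -/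
theorem fineSelmerInfty_le_fineSelmerInftyRelaxedInf : W.fineSelmerInfty κ ≤ W.fineSelmerInftyRelaxedInf κ :=
  GreenbergSelmer.fineSelmerInfty_le_fineSelmerInftyRelaxedInf (W.geomPrimaryTorsion p) κ

/-- `Sel₀^{rel ∞}(K_∞, E[p^∞])` is stable under `conj_γ`. [cite: Greenberg1989, §1 p. 98] -/
theorem conjH1_mem_fineSelmerInftyRelaxedInf {s : W.subgroupH1 p κ.kerSubgroup} (hs : s ∈ W.fineSelmerInftyRelaxedInf κ) :
    W.conjH1 p κ.kerSubgroup γ s ∈ W.fineSelmerInftyRelaxedInf κ :=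
  GreenbergSelmer.conjH1_mem_fineSelmerInftyRelaxedInf (W.geomPrimaryTorsion p) κ γ hs

/-- **Pontryagin-dual data for `Sel₀^{rel ∞}(K_∞, E[p^∞])`** (hypothesis structure — EXACTLY the pattern of
`WeierstrassCurve.FineSelmerDualData` with `Sel₀` replaced by `Sel₀^{rel ∞}`): the Iwasawa module
`X₀^{rel ∞} = Hom(Sel₀^{rel ∞}(K_∞, E[p^∞]), ℚ_p/ℤ_p)` as an abstract `Λ = ℤ_p⟦T⟧`-module `X` with `toDual : X ≃ Hom(Sel₀^{rel ∞}, ℚ/ℤ)`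
(`bijective`), `T` acting as `γ − 1` (`toDual_T_smul`) and constants `c ∈ ℤ_p` acting on `p^k`-torsion classes through `ℤ_p → ℤ/p^k`
(`toDual_C_smul`).  For `p = 2`, `K = F` with real places and `E[2] ⊂ E(F_v)`, `X₀^{rel ∞}` and `X₀` differ by a quotient of a sum of
copies of `Λ/2Λ` (Greenberg's archimedean factor). [cite: GreenbergLNM1716, §4, Lemma 4.6 and PDF pp. 106–107]
[cite: Kato2004Asterisque, Conj. 12.10 (p. 224)] -/
structure FineSelmerDualDataRelaxedInf where
  /-- The underlying type of the Iwasawa module `X₀^{rel ∞}(E/K_∞)`. -/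
  X : Type u
  /-- `X₀^{rel ∞}` is an abelian group. -/
  [addCommGroup : AddCommGroup X]
  /-- `X₀^{rel ∞}` is a `Λ = ℤ_p⟦T⟧`-module. -/
  [module : Module (IwasawaAlgebra p) X]
  /-- The identification of `X₀^{rel ∞}` with the character group `Hom(Sel₀^{rel ∞}(K_∞), ℚ/ℤ)`. -/
  toDual : X →+ (W.fineSelmerInftyRelaxedInf κ →+ AddCircle (1 : ℚ))
  /-- `toDual` is a group isomorphism. -/
  bijective : Function.Bijective toDual
  /-- `T` acts as `γ - 1`: `(T·x)(s) = x(conj_γ s) - x(s)`. -/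
  toDual_T_smul : ∀ (x : X) (s : W.fineSelmerInftyRelaxedInf κ),
    toDual ((PowerSeries.X : IwasawaAlgebra p) • x) s =
      toDual x ⟨W.conjH1 p κ.kerSubgroup γ s, W.conjH1_mem_fineSelmerInftyRelaxedInf κ γ s.2⟩ - toDual x s
  /-- Constants `c ∈ ℤ_p` act on `p^k`-torsion classes through `ℤ_p → ℤ/p^k`. -/
  toDual_C_smul : ∀ (c : ℤ_[p]) (x : X) (s : W.fineSelmerInftyRelaxedInf κ) (k : ℕ), (p ^ k) • s = 0 →
    toDual (PowerSeries.C c • x) s = (PadicInt.toZModPow k c).val • toDual x s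

attribute [instance] FineSelmerDualDataRelaxedInf.addCommGroup FineSelmerDualDataRelaxedInf.module

namespace FineSelmerDualDataRelaxedInf

variable {W κ γ} (D : W.FineSelmerDualDataRelaxedInf κ γ)

/-- The **characteristic ideal** `char_Λ X₀^{rel ∞}(E/K_∞) ⊆ Λ` of the dual of the fine Selmer group relaxed at `∞`.
[cite: Kato2004Asterisque, Conj. 12.10 (p. 224)] [cite: GreenbergLNM1716, §4, Lemma 4.6] -/
def charIdeal : Ideal (IwasawaAlgebra p) :=
  Literature.NumberTheory.EllipticCurves.Module.charIdeal (IwasawaAlgebra p) D.X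

/-- The restriction `Hom(Sel₀^{rel ∞}, ℚ/ℤ) → Hom(Sel₀, ℚ/ℤ)` dual to the inclusion `Sel₀ ≤ Sel₀^{rel ∞}`, read on `X₀^{rel ∞}`:
`x ↦ (toDual x) ∘ incl` — the map `X₀^{rel ∞} → X₀`-side characters whose kernel/cokernel carry Greenberg's archimedean `Λ/2Λ`'s.
[cite: GreenbergLNM1716, §4, Lemma 4.6 and PDF pp. 106–107] -/
def toFineDual : D.X →+ (W.fineSelmerInfty κ →+ AddCircle (1 : ℚ)) where
  toFun x := (D.toDual x).comp (AddSubgroup.inclusion (W.fineSelmerInfty_le_fineSelmerInftyRelaxedInf κ))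
  map_zero' := by ext s; simp
  map_add' x y := by ext s; simp

/-- Unfolding of `toFineDual`. [cite: GreenbergLNM1716, §4, Lemma 4.6] -/
theorem toFineDual_apply (x : D.X) (s : W.fineSelmerInfty κ) :
    D.toFineDual x s = D.toDual x (AddSubgroup.inclusion (W.fineSelmerInfty_le_fineSelmerInftyRelaxedInf κ) s) := rfl

end FineSelmerDualDataRelaxedInf

end WeierstrassCurve

/-! ## §3 Existence of the dual datum (non-vacuity), word for word `KatoFineSelmerDualProofs` -/

namespace WeierstrassCurve

open Literature.NumberTheory.EllipticCurves Literature.NumberTheory.EllipticCurves.IwasawaAlgebra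
  Literature.NumberTheory.EllipticCurves.IwasawaDual
  Literature.NumberTheory.EllipticCurves.ZpExtension

variable {K : Type u} [Field K] [NumberField K] (W : WeierstrassCurve K) {p : ℕ} [Fact p.Prime]
  (κ : ZpExtension K p)

/-- `conj_γ` restricted to an endomorphism of `Sel₀^{rel ∞}(K_∞, E[p^∞])` (it preserves it by
`conjH1_mem_fineSelmerInftyRelaxedInf`). [cite: GreenbergLNM1716, §1 (after Conj. 1.3)] -/
def conjFineSelmerInftyRelaxedInf (γ : Field.absoluteGaloisGroup K) :
    AddMonoid.End (W.fineSelmerInftyRelaxedInf κ) :=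
  ((W.conjH1 p κ.kerSubgroup γ).restrict (W.fineSelmerInftyRelaxedInf κ)).codRestrict
    (W.fineSelmerInftyRelaxedInf κ) fun s ↦ W.conjH1_mem_fineSelmerInftyRelaxedInf κ γ s.2

/-- Unfolding `conjFineSelmerInftyRelaxedInf` (definitional). [cite: GreenbergLNM1716, §1 (after Conj. 1.3)] -/
@[simp]
theorem coe_conjFineSelmerInftyRelaxedInf_apply (γ : Field.absoluteGaloisGroup K)
    (s : W.fineSelmerInftyRelaxedInf κ) :
    ((W.conjFineSelmerInftyRelaxedInf κ γ s : W.fineSelmerInftyRelaxedInf κ) :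
        W.subgroupH1 p κ.kerSubgroup) = W.conjH1 p κ.kerSubgroup γ s :=
  rfl

/-- Powers of the restriction are restrictions of `conj_{γ^m}`. [cite: GreenbergLNM1716, §1 (after Conj. 1.3)] -/
theorem coe_conjFineSelmerInftyRelaxedInf_pow_apply (γ : Field.absoluteGaloisGroup K) (m : ℕ)
    (s : W.fineSelmerInftyRelaxedInf κ) :
    ((((W.conjFineSelmerInftyRelaxedInf κ γ) ^ m) s : W.fineSelmerInftyRelaxedInf κ) :
        W.subgroupH1 p κ.kerSubgroup) = W.conjH1 p κ.kerSubgroup (γ ^ m) s := by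
  induction m generalizing s with
  | zero => rw [pow_zero, pow_zero, AddMonoid.End.one_apply, W.conjH1_one_holds p κ.kerSubgroup,
      AddMonoidHom.id_apply]
  | succ m ih =>
    rw [pow_succ, AddMonoid.End.coe_mul, Function.comp_apply, ih,
      coe_conjFineSelmerInftyRelaxedInf_apply, pow_succ, W.conjH1_mul_holds p κ.kerSubgroup,
      AddMonoidHom.comp_apply]

/-- `Sel₀^{rel ∞}(K_∞, E[p^∞])` is `p`-primary and `T = γ − 1` is locally nilpotent on it, for `γ` a topological generator
(both are statements about all of `H¹(K_∞, E[p^∞])`). [cite: GreenbergLNM1716, §1 (after Conj. 1.3)] -/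
theorem isLocNil_conjFineSelmerInftyRelaxedInf_sub_one {γ : Field.absoluteGaloisGroup K}
    (hγ : κ.IsTopGenerator γ) : IwasawaDual.IsLocNil p (W.conjFineSelmerInftyRelaxedInf κ γ - 1) := by
  have htor : ∀ s : W.fineSelmerInftyRelaxedInf κ, ∃ k : ℕ, p ^ k • s = 0 := fun s ↦ by
    obtain ⟨k, hk⟩ := W.exists_pow_smul_subgroupH1_ker_eq_zero κ (s : W.subgroupH1 p κ.kerSubgroup)
    exact ⟨k, Subtype.ext (by rw [AddSubgroupClass.coe_nsmul]; exact hk)⟩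
  refine ⟨htor, fun s ↦ ?_⟩
  obtain ⟨a, ha⟩ := W.exists_conjH1_pow_prime_pow_eq κ hγ (s : W.subgroupH1 p κ.kerSubgroup)
  obtain ⟨k, hk⟩ := htor s
  have hφ : ((W.conjFineSelmerInftyRelaxedInf κ γ) ^ p ^ a) s = s :=
    Subtype.ext (by rw [coe_conjFineSelmerInftyRelaxedInf_pow_apply]; exact ha)
  exact ⟨k * p ^ a, IwasawaDual.pow_mul_prime_pow_apply_eq_zero (Fact.out : p.Prime) _ a hφ hk⟩

/-- **The dual `X₀^{rel ∞}(E/K_∞) = Hom(Sel₀^{rel ∞}(K_∞, E[p^∞]), ℚ/ℤ)` with its `Λ`-module structure**, packaged as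
`W.FineSelmerDualDataRelaxedInf κ γ` (`X` = the character group, `toDual = id`, module structure `IsLocNil.module`).
[cite: GreenbergLNM1716, §1 (after Conj. 1.3)] [cite: CoatesSujatha2005, §3] -/
def fineSelmerDualDataRelaxedInf {γ : Field.absoluteGaloisGroup K} (hγ : κ.IsTopGenerator γ) :
    W.FineSelmerDualDataRelaxedInf κ γ :=
  { X := W.fineSelmerInftyRelaxedInf κ →+ AddCircle (1 : ℚ)
    module := (W.isLocNil_conjFineSelmerInftyRelaxedInf_sub_one κ hγ).module
    toDual := AddMonoidHom.id _
    bijective := Function.bijective_id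
    toDual_T_smul := fun x s ↦ by
      show (W.isLocNil_conjFineSelmerInftyRelaxedInf_sub_one κ hγ).smulFun PowerSeries.X x s = x _ - x s
      rw [(W.isLocNil_conjFineSelmerInftyRelaxedInf_sub_one κ hγ).smulFun_X_apply,
        IwasawaDual.End_sub_apply, AddMonoid.End.one_apply, map_sub]
      rfl
    toDual_C_smul := fun c x s k hk ↦ by
      show (W.isLocNil_conjFineSelmerInftyRelaxedInf_sub_one κ hγ).smulFun (PowerSeries.C c) x s = _
      exact (W.isLocNil_conjFineSelmerInftyRelaxedInf_sub_one κ hγ).smulFun_C_apply c x hk }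

/-- **Existence / non-vacuity**: for `γ` a topological generator, `W.FineSelmerDualDataRelaxedInf κ γ` is inhabited.
[cite: GreenbergLNM1716, §1 (after Conj. 1.3)] [cite: CoatesSujatha2005, §3] -/
theorem nonempty_fineSelmerDualDataRelaxedInf {γ : Field.absoluteGaloisGroup K} (hγ : κ.IsTopGenerator γ) :
    Nonempty (W.FineSelmerDualDataRelaxedInf κ γ) :=
  ⟨W.fineSelmerDualDataRelaxedInf κ hγ⟩

/-- For EVERY `ℤ_p`-extension `κ` the relaxed-at-`∞` dual fine Selmer datum exists for some topological generator `γ`.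
[cite: GreenbergLNM1716, §1 (after Conj. 1.3)] [cite: CoatesSujatha2005, §3] -/
theorem exists_fineSelmerDualDataRelaxedInf :
    ∃ (γ : Field.absoluteGaloisGroup K) (_ : κ.IsTopGenerator γ), Nonempty (W.FineSelmerDualDataRelaxedInf κ γ) :=
  have ⟨γ, hγ⟩ : ∃ γ : Field.absoluteGaloisGroup K, κ.IsTopGenerator γ :=
    κ.surjective (Multiplicative.ofAdd 1)
  ⟨γ, hγ, W.nonempty_fineSelmerDualDataRelaxedInf κ hγ⟩

end WeierstrassCurve

end
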